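import Mathlib
import HarnessLib
import Summits.HubbardSuperconductivity.HubbardSuperconductivity.Theorems.KLProgrammeKLRegimeSectorSliceGramFatAnnulus
import Summits.HubbardSuperconductivity.HubbardSuperconductivity.Theorems.KLProgrammeH10TwoPointLimitFrameSectorCell

/-!
# Route `KLProgramme` — ENGINE item stmt-HubbardSuperconductivity-20437, class #6 / (E5-F)ₙ producer, route (M): M1 calibration, piece 1 —
# the SUPPORT COUNT of one isotropic multiplier at resolution `m` on an admissible frame (frequency window × thin shell in the sector cell,
# sagitta-free), the `∏_{j<3} #supp F̄_{m,ω_{j+1}}` factor of `fixedTupleL1_klIsoKernelAt_le_of_value_moments_counts`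

Cell gate-hubbard-kl, seat hubbard-kl-k3c2-p2 (g11; owner-designate of M1 + M3 of route (M), pen (R59az)).  The M3 shape (`…EngineIsoBoxNearFar`, p574730) reads three support
counts `#{k : F̄_{m,ω}(k) ≠ 0}` of the iso family `klIsoFamily … K e₀ m`.  On an admissible frame (`B : BandBounds a b`, frame `C²` size `A` with `2A < Dt_min`, `μ` inside the
level range with margin `A + e₀`) the support sits in the time window `|ω| < Λ_m` times the thin shell `|e_K| < Λ_m` inside the sup-norm box of radius
`ρ_m = (Λ_m + s_max·Dt_min·(3 w_{2m}/4))/(Dt_min − 2A)` around the frame's Fermi point at the sector centre (`support_klIsoFamily`, `support_klIsoFamily_cell`), and the shell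
is counted ALONG COORDINATE FIBRES (this lineage's `card_filter_shell_box_le`, p548755: area `Λ_m·ρ_m`, no sagitta `K₂ρ_m²` — at `ρ_m ≍ 150 Λ_m` the sagitta would cost a
factor `≍ 5000·4^{-m}` per leg):

* **`card_support_klIsoFamily_le`** — `#{k : F̄_{m,ω}(k) ≠ 0} ≤ (Λ_m β/π + 3)·2(ρ_m L/π + 1)·(8π(4+4A)/λ + 1)·(4Λ_m L/(πλ) + 2)`, uniformly in the sector `ω`, where `λ` is a
  coordinate-gradient floor of the frame band on the shell `|e_K| ≤ Λ_m` (from `GeomConstants` via `coord_floor_of_le_norm_gradient` in the engine's use); the two factors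
  (time window `∝ β`, momentum cell `∝ L²·Λ_m·ρ_m`) are what the M1 calibration `ε·N_R·#supp/(βL²) = O(ρ³)` consumes.

Left to M1 proper: the product with the near count `N_R ≤ (2R/ε + 2)(2R + 2)²` (`card_spaceTimeBall_le_real`, p567688) at `R = ρ/Λ_m`, i.e. the dimensionless `c₀⁹ρ⁹`, and the
registered-binder instance (frame data from `FrameOK` as in `gram_softShaped_bgmFat_sharp_of_thresholds`).  Everything is proved; no definitions; nothing about the model is asserted.
References: BGM 2006 §2.5 (2.57), §2.7 (2.66)–(2.69) [cite: BenfattoGiulianiMastropietro2006].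
-/

noncomputable section

namespace Summit.HubbardSuperconductivity.HubbardSuperconductivity.Theorems.EngineV8

set_option linter.dupNamespace false -- summit = problem name (single-conjunct summit), D-0017

open Set Finset Literature.MathematicalPhysics.QuantumLattice Literature.MathematicalPhysics.QuantumLattice.BandSectorCounting
open Literature.MathematicalPhysics.QuantumLattice.FermiRG Literature.Probability.LatticeModels Literature.Analysis.SpecialFunctions
open Summit.HubbardSuperconductivity.HubbardSuperconductivity.Theorems.DispersionFlow
open Summit.HubbardSuperconductivity.HubbardSuperconductivity.Theorems.KLRegimeSplit
open Summit.HubbardSuperconductivity.HubbardSuperconductivity.Theorems.KLProgrammeLegKernels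
open Summit.HubbardSuperconductivity.HubbardSuperconductivity.Theorems.PerturbedFermiCurve
open Summit.HubbardSuperconductivity.HubbardSuperconductivity.Theorems.TorusFourierL2
open scoped Real Nat

section IsoSupport

open Classical

variable {L M : ℕ} [NeZero L] {a b : ℝ} (B : BandBounds a b) {K : TrigPolyC4v} {A : ℝ}
  (hA : ∀ p : Momentum, ∀ j ≤ 2, ‖iteratedFDeriv ℝ j (frameShift K) p‖ ≤ A) (hADt : 2 * A < B.Dtmin)
  {μ e₀ β : ℝ} (he : 0 < e₀) (hlo : a ≤ μ - A - e₀) (hhi : μ + A + e₀ ≤ b) (hβ : 0 < β) (m : ℕ)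
  {lam : ℝ} (hlam : 0 < lam)
  (hgradK : ∀ p : Fin 2 → ℝ, |frameLevel μ K (WithLp.toLp 2 p)| ≤ klScale e₀ m →
    lam ≤ |fderiv ℝ (fun q : Fin 2 → ℝ => frameLevel μ K (WithLp.toLp 2 q)) p (Pi.single 0 1)| ∨
      lam ≤ |fderiv ℝ (fun q : Fin 2 → ℝ => frameLevel μ K (WithLp.toLp 2 q)) p (Pi.single 1 1)|)

include B hA hADt he hlo hhi hβ hlam hgradK in
/-- **SUPPORT COUNT OF ONE ISOTROPIC MULTIPLIER** (uniform in the sector `ω`): `#{k : F̄_{m,ω}(k) ≠ 0} ≤ (Λ_m β/π + 3)·2(ρ_m L/π + 1)·(8π(4+4A)/λ + 1)·(4Λ_m L/(πλ) + 2)`,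
`ρ_m = (Λ_m + s_max·Dt_min·(3 w_{2m}/4))/(Dt_min − 2A)` — time window `|ω| < Λ_m` × thin shell `|e_K| < Λ_m` inside the sup-norm box of radius `ρ_m` around `p_F(θ_{2m,ω})`,
the shell counted along coordinate fibres (no sagitta). [cite: BenfattoGiulianiMastropietro2006, §2.7 (2.69)] -/
theorem card_support_klIsoFamily_le (ω : Fin (sectorCount (2 * m))) :
    ((((univ : Finset (FreqMomentum L M)).filter fun k => klIsoFamily L M β μ K e₀ m ω k ≠ 0).card : ℕ) : ℝ) ≤
      (klScale e₀ m * β / π + 3) *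
        (2 * (((klScale e₀ m + B.smax * B.Dtmin * (3 * sectorWidth (2 * m) / 4)) / (B.Dtmin - 2 * A)) * L / π + 1) *
          ((8 * π * (4 + 4 * A) / lam + 1) * (4 * klScale e₀ m * L / (π * lam) + 2))) := by
  classical
  have hΛe := klScale_le_e0 he.le m
  have hlo' : a ≤ μ - A - klScale e₀ m := by linarith only [hlo, hΛe]
  have hhi' : μ + A + klScale e₀ m ≤ b := by linarith only [hhi, hΛe]
  have hA0 : 0 ≤ A := (norm_nonneg _).trans (hA 0 0 (by norm_num))
  have hDt : 0 < B.Dtmin - 2 * A := by linarith only [hADt]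
  have hΛ0 : 0 < klScale e₀ m := by rw [klScale]; positivity
  set ρ₀ : ℝ := (klScale e₀ m + B.smax * B.Dtmin * (3 * sectorWidth (2 * m) / 4)) / (B.Dtmin - 2 * A) with hρ₀
  have hρ0 : 0 ≤ ρ₀ := by
    have := B.smax_pos; have := B.Dtmin_pos; have := sectorWidth_pos (2 * m)
    positivity
  set pF : Fin 2 → ℝ := klFermiPoint μ K (sectorCenter (2 * m) ω) with hpF
  set eK : (Fin 2 → ℝ) → ℝ := fun p => frameLevel μ K (WithLp.toLp 2 p) with heK
  set pt : TorusSite 2 L → (Fin 2 → ℝ) := fun k j => 2 * π * (((k j).valMinAbs : ℤ) : ℝ) / L with hpt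
  have hpt_eq : ∀ k : TorusSite 2 L, pt k = torusCentredMomentum L k := by
    intro k; rw [torusCentredMomentum_eq_valMinAbs]; funext j; simp only [hpt]; ring
  -- the two one-variable predicates
  set P : MatsubaraIdx M → Prop := fun i => |matsubaraFreq β M i| ≤ klScale e₀ m with hP
  set Q : TorusSite 2 L → Prop := fun k => |eK (pt k)| ≤ klScale e₀ m ∧ ‖pt k - pF‖ ≤ ρ₀ with hQ
  -- the support is inside `P × Q`
  have hsub : ((univ : Finset (FreqMomentum L M)).filter fun k => klIsoFamily L M β μ K e₀ m ω k ≠ 0) ⊆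
      (univ : Finset (FreqMomentum L M)).filter fun k => P k.1 ∧ Q k.2 := by
    intro k hk
    rw [mem_filter] at hk
    obtain ⟨-, hF⟩ := hk
    obtain ⟨he', hω, -⟩ := support_klIsoFamily L M he β μ K m ω k hF
    have heKk : eK (pt k.2) = nambuXiCT L μ K k.2 := by
      simp only [heK]; rw [hpt_eq, ← nambuXiCT_eq_frameLevel L μ K k.2]
    rw [mem_filter]
    refine ⟨mem_univ _, hω.le, ?_, ?_⟩
    · rw [heKk]; exact he'.le
    · -- the iso cell, coordinatewise, then the sup norm
      refine (pi_norm_le_iff_of_nonneg hρ0).2 fun i => ?_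
      rw [Real.norm_eq_abs, Pi.sub_apply, hpt_eq]
      exact support_klIsoFamily_cell B hA hADt L M he β m hlo' hhi' ω k hF i
  -- the product count
  have hprod := card_filter_freqMomentum_eq (L := L) (M := M) P Q
  -- the time window
  have hT : ((((univ : Finset (MatsubaraIdx M)).filter P).card : ℝ)) ≤ klScale e₀ m * β / π + 3 :=
    card_filter_matsubaraFreq_le hβ hΛ0.le _ fun i hi => (mem_filter.1 hi).2
  -- the thin shell inside the box, along fibres
  have hX : ((((univ : Finset (TorusSite 2 L)).filter Q).card : ℝ)) ≤
      2 * (ρ₀ * L / π + 1) * ((8 * π * (4 + 4 * A) / lam + 1) * (4 * klScale e₀ m * L / (π * lam) + 2)) := by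
    refine card_filter_shell_box_le L (contDiff_frameBand μ K) (by positivity : (0 : ℝ) < 4 + 4 * A)
      (norm_iteratedFDeriv_two_frameBand_le hA μ) hΛ0.le hlam hρ0 pF _ (fun k hk => (mem_filter.1 hk).2) fun k hk => ?_
    exact hgradK (pt k) (mem_filter.1 hk).2.1
  calc _ ≤ ((((univ : Finset (FreqMomentum L M)).filter fun k => P k.1 ∧ Q k.2).card : ℕ) : ℝ) := by exact_mod_cast Finset.card_le_card hsub
    _ = (((univ : Finset (MatsubaraIdx M)).filter P).card : ℝ) * (((univ : Finset (TorusSite 2 L)).filter Q).card : ℝ) := by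
        rw [hprod]; push_cast; ring
    _ ≤ _ := mul_le_mul hT hX (Nat.cast_nonneg _) (by positivity)

end IsoSupport

/-! ## §2 (appended) The per-leg calibration factor `ε·N_R·#supp/(βL²)` of the M3 shape -/

section Calibration

open Classical

variable {L M : ℕ} [NeZero L] {a b : ℝ} (B : BandBounds a b) {K : TrigPolyC4v} {A : ℝ}
  (hA : ∀ p : Momentum, ∀ j ≤ 2, ‖iteratedFDeriv ℝ j (frameShift K) p‖ ≤ A) (hADt : 2 * A < B.Dtmin)
  {μ e₀ β : ℝ} (he : 0 < e₀) (hlo : a ≤ μ - A - e₀) (hhi : μ + A + e₀ ≤ b) (hβ : 0 < β) (m : ℕ)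
  {lam : ℝ} (hlam : 0 < lam)
  (hgradK : ∀ p : Fin 2 → ℝ, |frameLevel μ K (WithLp.toLp 2 p)| ≤ klScale e₀ m →
    lam ≤ |fderiv ℝ (fun q : Fin 2 → ℝ => frameLevel μ K (WithLp.toLp 2 q)) p (Pi.single 0 1)| ∨
      lam ≤ |fderiv ℝ (fun q : Fin 2 → ℝ => frameLevel μ K (WithLp.toLp 2 q)) p (Pi.single 1 1)|)

include B hA hADt he hlo hhi hβ hlam hgradK in
/-- **The support count per unit space-time volume**: `#{F̄_{m,ω} ≠ 0}/(βL²) ≤ (Λ_m/π + 3/β)·2(ρ_m/π + 1/L)·(8π(4+4A)/λ + 1)·(4Λ_m/(πλ) + 2/L)`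
(`card_support_klIsoFamily_le` divided by `βL²`). -/
theorem card_support_klIsoFamily_div_le (ω : Fin (sectorCount (2 * m))) :
    ((((univ : Finset (FreqMomentum L M)).filter fun k => klIsoFamily L M β μ K e₀ m ω k ≠ 0).card : ℕ) : ℝ) / (β * (L : ℝ) ^ 2) ≤
      (klScale e₀ m / π + 3 / β) *
        (2 * (((klScale e₀ m + B.smax * B.Dtmin * (3 * sectorWidth (2 * m) / 4)) / (B.Dtmin - 2 * A)) / π + 1 / L) *
          ((8 * π * (4 + 4 * A) / lam + 1) * (4 * klScale e₀ m / (π * lam) + 2 / L))) := by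
  have hL : (0 : ℝ) < (L : ℝ) := Nat.cast_pos.2 (NeZero.pos L)
  have h := card_support_klIsoFamily_le (L := L) (M := M) B hA hADt he hlo hhi hβ m hlam hgradK ω
  rw [div_le_iff₀ (by positivity)]
  refine h.trans (le_of_eq ?_)
  field_simp

include B hA hADt he hlo hhi hβ hlam hgradK in
/-- **The same, simplified under mild thresholds** (`π/β ≤ Λ_m`, i.e. `m ≤ n_β`; `L` large against `π/ρ_m` and `πλ/(2Λ_m)`):
`#{F̄_{m,ω} ≠ 0}/(βL²) ≤ (128/(π³λ))·(8π(4+4A)/λ + 1)·ρ_m·Λ_m²` — (cell length `ρ_m ≍ Λ_m`) × (shell thickness `Λ_m`) × (time window `Λ_m`, per unit `β`): the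
scale-covariant shape `≍ Λ_m³` that the near count `ε·N_R ≍ (ρ/Λ_m)³` compensates. -/
theorem card_support_klIsoFamily_div_le_simple (ω : Fin (sectorCount (2 * m))) (hβΛ : π / β ≤ klScale e₀ m)
    (hL1 : π ≤ ((klScale e₀ m + B.smax * B.Dtmin * (3 * sectorWidth (2 * m) / 4)) / (B.Dtmin - 2 * A)) * L)
    (hL2 : π * lam ≤ 2 * klScale e₀ m * L) :
    ((((univ : Finset (FreqMomentum L M)).filter fun k => klIsoFamily L M β μ K e₀ m ω k ≠ 0).card : ℕ) : ℝ) / (β * (L : ℝ) ^ 2) ≤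
      128 / (π ^ 3 * lam) * (8 * π * (4 + 4 * A) / lam + 1) *
        (((klScale e₀ m + B.smax * B.Dtmin * (3 * sectorWidth (2 * m) / 4)) / (B.Dtmin - 2 * A)) * klScale e₀ m ^ 2) := by
  have hL : (0 : ℝ) < (L : ℝ) := Nat.cast_pos.2 (NeZero.pos L)
  have hπ := Real.pi_pos
  have hA0 : 0 ≤ A := (norm_nonneg _).trans (hA 0 0 (by norm_num))
  have hDt : 0 < B.Dtmin - 2 * A := by linarith only [hADt]
  have hΛ0 : 0 < klScale e₀ m := by rw [klScale]; positivity
  set Λ := klScale e₀ m with hΛdef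
  set ρ₀ : ℝ := (klScale e₀ m + B.smax * B.Dtmin * (3 * sectorWidth (2 * m) / 4)) / (B.Dtmin - 2 * A) with hρ₀
  have hρ0 : 0 < ρ₀ := by
    have := B.smax_pos; have := B.Dtmin_pos; have := sectorWidth_pos (2 * m)
    positivity
  set Kf : ℝ := 8 * π * (4 + 4 * A) / lam + 1 with hKf
  have hKf0 : 0 < Kf := by rw [hKf]; positivity
  have h := card_support_klIsoFamily_div_le (L := L) (M := M) B hA hADt he hlo hhi hβ m hlam hgradK ω
  -- the three factor bounds
  have h1 : Λ / π + 3 / β ≤ 4 * Λ / π := by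
    have : 3 / β ≤ 3 * Λ / π := by
      rw [div_le_div_iff₀ hβ hπ]
      have := (div_le_iff₀ hβ).1 hβΛ
      nlinarith [this]
    have e : 4 * Λ / π = Λ / π + 3 * Λ / π := by ring
    linarith [this, e]
  have h2 : 2 * (ρ₀ / π + 1 / L) ≤ 4 * ρ₀ / π := by
    have : 1 / (L : ℝ) ≤ ρ₀ / π := by rw [div_le_div_iff₀ hL hπ]; linarith [hL1]
    have e : 4 * ρ₀ / π = 2 * (ρ₀ / π + ρ₀ / π) := by ring
    linarith [this, e]
  have h3 : 4 * Λ / (π * lam) + 2 / L ≤ 8 * Λ / (π * lam) := by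
    have : 2 / (L : ℝ) ≤ 4 * Λ / (π * lam) := by
      rw [div_le_div_iff₀ hL (by positivity)]; nlinarith [hL2]
    have e : 8 * Λ / (π * lam) = 4 * Λ / (π * lam) + 4 * Λ / (π * lam) := by ring
    linarith [this, e]
  have h10 : 0 ≤ Λ / π + 3 / β := by positivity
  have h20 : 0 ≤ 2 * (ρ₀ / π + 1 / L) := by positivity
  have h30 : 0 ≤ 4 * Λ / (π * lam) + 2 / L := by positivity
  calc _ ≤ (Λ / π + 3 / β) * (2 * (ρ₀ / π + 1 / L) * (Kf * (4 * Λ / (π * lam) + 2 / L))) := h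
    _ ≤ (4 * Λ / π) * ((4 * ρ₀ / π) * (Kf * (8 * Λ / (π * lam)))) := by
        refine mul_le_mul h1 (mul_le_mul h2 (mul_le_mul_of_nonneg_left h3 hKf0.le) (by positivity) (by positivity)) (by positivity)
          (by positivity)
    _ = 128 / (π ^ 3 * lam) * Kf * (ρ₀ * Λ ^ 2) := by
        field_simp
        ring

/-- **The near coefficient of the M3 shape factorises per leg**: `ε³·N_R³·(∏_{j<3} S_j)/(βL²)³ = ∏_{j<3} (ε·N_R·S_j/(βL²))`. -/
theorem near_coefficient_eq_prod (ε NR β : ℝ) (L : ℕ) (S : Fin 3 → ℝ) :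
    ε ^ 3 * NR ^ 3 * (∏ j, S j) / (β * (L : ℝ) ^ 2) ^ 3 = ∏ j, (ε * NR * S j / (β * (L : ℝ) ^ 2)) := by
  rw [Fin.prod_univ_three, Fin.prod_univ_three]
  ring

/-- **The time weight times the near count**: with `N_R ≤ (2R/ε + 2)(2R + 2)²` (`card_spaceTimeBall_le_real`), `ε·N_R ≤ (2R + 2ε)(2R + 2)²` (`ε > 0`). -/
theorem eps_mul_nearCount_le {ε NR R : ℝ} (hε : 0 < ε) (hN : NR ≤ (2 * R / ε + 2) * (2 * R + 2) ^ 2) :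
    ε * NR ≤ (2 * R + 2 * ε) * (2 * R + 2) ^ 2 := by
  have h := mul_le_mul_of_nonneg_left hN hε.le
  have e : ε * ((2 * R / ε + 2) * (2 * R + 2) ^ 2) = (2 * R + 2 * ε) * (2 * R + 2) ^ 2 := by
    field_simp
  linarith [h, e]

end Calibration

end Summit.HubbardSuperconductivity.HubbardSuperconductivity.Theorems.EngineV8

end
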